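/-
Copyright: the b2b-balaban T⁴-continuum CRUX team, row NE7b leaf lineage `t4-ne7b-formalise-leaf-06` (gen 158). Project licence.
-/
import Summits.QuantumFields.BalabanUV.T4Continuum.Spine.NE7b.OneShotChartStrip
import Summits.QuantumFields.BalabanUV.T4Continuum.Spine.NE7b.OneShotChartPaleyWiener

/-!
# THE ONE-SHOT SECTION's SUP-ROW LETTER IN ROAD-B SHAPE, EVERY `d`, UNIFORMLY IN THE MESH:
# `Σ_{y∈T}|H(chart n x τ, y)| ≤ NF_T(r₀) + √(tail count)·√(2(d+1))·C` for `0 ≤ q ≤ κ`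
# (the companions' (CT-1) strip + (CT-2) Paley–Wiener, assembled on the OWNER's (41) Fourier form; row NE7b, node U5c; [folklore] bookkeeping)

Cell `pub-balaban`, sub-cell `t4`, spine estimate NE7b (`T4WeightBudget.RelWeightBound`; the cell's OWN estimate — NOT PRINTED in
[Bałaban 1983–89], NOT PROVED).  Crux-route work under `Spine/NE7b/` by leaf-06 (CRUX team (2), FREEZE (0) crux-prover clause).
NOTHING of Bałaban's is named as a Lean object, valued or asserted; no `T4Continuum/Support` leaf typed; no `def`; zero `sorry`.

WHY.  NL-NE7b-1 limb 1 (PRICING-NE7b v121 F721; T-109) asks for the chart constant of the one-shot section `H = G′Q′*(Q′G′Q′*)⁻¹` in the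
SUP currency `…HardStepRadiusSupNorm` consumes.  The OWNER's (46) `…OneShotChartSupNorm` gives it on `ℤ^d` for `d ≥ 3` from the β-team's
elliptic-regularity bound (constant existential in `d`).  The companions give Road B's pieces for EVERY `d + 1`: (CT-1)
`…OneShotChartStrip.exists_stripRegular_oneShot` (the one-shot multiplier is `StripRegular κ C`, `κ, C` closed forms in `d, a`) and (CT-2)
`…OneShotChartPaleyWiener.row_letter` (the `ℓ¹` row of a strip-regular multiplier's kernel ≤ near field + Cauchy–Schwarz tail).  THIS FILE
assembles them on the one-shot section through the OWNER's (41) `kerH_chart_eq_latticeKernel` (block rows of `H` = lattice kernel of the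
multiplier).  The qualitative row-sum ∕ `ℓ^∞` letters themselves are the OWNER's (46) (`…OneShotChartSupNorm`, to be made `d`-free by
an append citing the companion's `exists_kerH_decay` — W-ne7bp1-g113-2 (a)); THIS FILE stays on the Road-B SHAPE.

WHAT IS PROVED (`a > 0`; `kerH` of `B5Hk103ScalarZd`, `chart ∕ blk` of `B6QGQLower276`; finite windows `T`; all [folklore]):
* §1 `sum_abs_kerH_chart_eq` (the row over `T` at a chart point = the kernel's `ℓ¹` sum over the reflected window `x − T`).
* §2 **`exists_oneShot_row_letter`**: `∃ κ > 0, ∃ C > 0` (d, a only), `∀ n x τ T r₀`, `∀ q ∈ [0, κ]`: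
  `Σ_{y∈T}|H(chart n x τ, y)| ≤ Σ_{y∈T, |x−y|_∞≤r₀}|H(chart n x τ, y)| + √(Σ_{y∈T,|x−y|_∞>r₀}e^{−2q|x−y|_∞})·(√(2(d+1))·C)` — ROAD B's LETTER
  SHAPE for the one-shot section, uniformly in the mesh (near field and tail count displayed).

HONEST BY VALUE: `κ, C` are the B4 strip column's crude closed forms — EMPTY against `M^{(d−1)∕2}` at every `M` of record (T-109's certified
`q ≈ 0.9`, `W ≈ 2–3.4`, `NF` are balaban-calc's (CT-3), to be substituted into §2's shape); (46) is the letter of record; nothing by value here.  The torus identification (CT-4) and anything of (A3) ∕ NC-NE7b-α are NOT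
here.  BY-NAME EFFECT ON THE WALL: NONE.  NE7b NOT PRINTED ∕ NOT PROVED; spine PROVED 0∕9; rung (B)+1 on a FINITE torus — NOT infinite volume,
NOT the mass gap, NOT Clay.  HONEST DEPENDENCY: continuum YM on T⁴ ⇐ BetaPertH ∧ nine spine estimates (0∕9 proved); BetaPertH ⇐ (D1) ∧ (D4) ∧
CAP+tail; G-an2-4 gates asym, D1 and NE2∕3∕4.
-/

set_option autoImplicit false

namespace Summit.QuantumFields.BalabanUV.T4Continuum.NE7b.OneShotChartRowLetter

open Complex Finset
open Literature.MathematicalPhysics.QuantumFieldTheory.Balaban1983to89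
open B4ContourShift (StripRegular latticeKernel supNorm)
open B4StripSums (G)
open B6QGQFourier275Zd (symbQGQ)
open B6QGQLower276 (X chart)
open B5Hk103ScalarZd (kerH)
open OneShotChartFourier (kerH_chart_eq_latticeKernel)
open OneShotChartStrip (exists_stripRegular_oneShot)
open OneShotChartPaleyWiener (row_letter)
open scoped Real

variable {d : ℕ}

/-! ## §1. The row at a chart point is the kernel's `ℓ¹` sum over the reflected window -/

/-- `|H(chart n x τ, y)| = ‖K_τ(x − y)‖` with `K_τ` the lattice kernel of the one-shot multiplier (the OWNER's (41)). [folklore] -/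
theorem abs_kerH_chart_eq (n : ℕ) {a : ℝ} (ha : 0 < a) (x y : X (d + 1)) (τ : Fin (d + 1) → Fin (n + 1)) :
    |kerH n a (chart n x τ) y| = ‖latticeKernel (fun P => G (n + 1) a 0 τ P / symbQGQ (n + 1) a P) (x - y)‖ := by
  rw [← kerH_chart_eq_latticeKernel n ha x y τ, Complex.norm_real, Real.norm_eq_abs]

/-- the row over a finite window `T`, reflected: `Σ_{y∈T}|H(chart n x τ, y)| = Σ_{b ∈ x − T}‖K_τ(b)‖`. [folklore] -/
theorem sum_abs_kerH_chart_eq (n : ℕ) {a : ℝ} (ha : 0 < a) (x : X (d + 1)) (τ : Fin (d + 1) → Fin (n + 1))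
    (T : Finset (X (d + 1))) :
    ∑ y ∈ T, |kerH n a (chart n x τ) y|
      = ∑ b ∈ T.image (fun y => x - y), ‖latticeKernel (fun P => G (n + 1) a 0 τ P / symbQGQ (n + 1) a P) b‖ := by
  rw [Finset.sum_image (fun y _ y' _ h => sub_right_injective h)]
  exact Finset.sum_congr rfl fun y _ => abs_kerH_chart_eq n ha x y τ

/-! ## §2. Road B's letter shape for the one-shot section, uniformly in the mesh -/

/-- **THE ONE-SHOT SECTION's ROW LETTER IN ROAD-B SHAPE** (near field + Cauchy–Schwarz tail, (CT-1) + (CT-2) assembled): there are `κ > 0`,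
`C > 0` depending on `d, a` only such that for EVERY mesh `n`, block `x`, offset `τ`, finite window `T`, radius `r₀` and `0 ≤ q ≤ κ`,
`Σ_{y∈T}|H(chart n x τ, y)| ≤ Σ_{y∈T,|x−y|_∞≤r₀}|H(chart n x τ, y)| + √(Σ_{y∈T,|x−y|_∞>r₀}e^{−2q|x−y|_∞})·(√(2(d+1))·C)`. [folklore] -/
theorem exists_oneShot_row_letter (d : ℕ) {a : ℝ} (ha : 0 < a) :
    ∃ κ C : ℝ, 0 < κ ∧ 0 < C ∧ ∀ (n : ℕ) (x : X (d + 1)) (τ : Fin (d + 1) → Fin (n + 1)) (T : Finset (X (d + 1)))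
      (r₀ q : ℝ), 0 ≤ q → q ≤ κ →
      ∑ y ∈ T, |kerH n a (chart n x τ) y|
        ≤ ∑ y ∈ T.filter (fun y => supNorm (x - y) ≤ r₀), |kerH n a (chart n x τ) y|
          + Real.sqrt (∑ y ∈ T.filter (fun y => ¬ supNorm (x - y) ≤ r₀), Real.exp (-(2 * q * supNorm (x - y))))
            * (Real.sqrt (2 * (d + 1)) * C) := by
  obtain ⟨κ, C, hκ, hC, hreg⟩ := exists_stripRegular_oneShot d ha
  refine ⟨κ, C, hκ, hC, fun n x τ T r₀ q hq0 hqκ => ?_⟩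
  have h := row_letter (hreg n τ) hC.le hq0 hqκ r₀ (T.image (fun y => x - y))
  -- translate the three window sums back from `b = x − y` to `y`
  have hinj : ∀ S : Finset (X (d + 1)), Set.InjOn (fun y => x - y) S := fun S y _ y' _ hy => sub_right_injective hy
  have e0 := sum_abs_kerH_chart_eq n ha x τ T
  have e1 : ∑ b ∈ (T.image (fun y => x - y)).filter (fun b => supNorm b ≤ r₀),
        ‖latticeKernel (fun P => G (n + 1) a 0 τ P / symbQGQ (n + 1) a P) b‖
      = ∑ y ∈ T.filter (fun y => supNorm (x - y) ≤ r₀), |kerH n a (chart n x τ) y| := by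
    rw [Finset.filter_image, Finset.sum_image fun y _ y' _ h => sub_right_injective h]
    exact Finset.sum_congr rfl fun y _ => (abs_kerH_chart_eq n ha x y τ).symm
  have e2 : ∑ b ∈ (T.image (fun y => x - y)).filter (fun b => ¬ supNorm b ≤ r₀), Real.exp (-(2 * q * supNorm b))
      = ∑ y ∈ T.filter (fun y => ¬ supNorm (x - y) ≤ r₀), Real.exp (-(2 * q * supNorm (x - y))) := by
    rw [Finset.filter_image, Finset.sum_image fun y _ y' _ h => sub_right_injective h]
  rw [e0]
  rw [e1, e2] at h
  exact h

end Summit.QuantumFields.BalabanUV.T4Continuum.NE7b.OneShotChartRowLetter
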